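import Summits.FinalStateConjecture.FinalStateConjecture.Theses.BartnikGapSettling
import Literature.Geometry.Lorentzian.BondiBartnikGap

/-!
# Route BartnikGapSettling — crux `BondiBartnikRigidity` (stmt-FinalStateConjecture-10807), negative
# side: the filed text is false on a development with a blind collapsed leaf

`BondiBartnikRigidity` (Theses file rev 2) is
`∀ χ m₀ N₀ k ε, χ < 1 → 0 < m₀ → 0 < ε → ∃ k', ∀ Λ < ⊤, ∃ δ γ > 0, ∀ admissible MGHD 𝒟, ∀ N M a S p …,
⟨(Λ, k')-near-Kerr leaf S with N ≤ N₀ thick δ-collars, p ∈ S, a cut Bondi energy of the core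
{p} ∪ ⋃ collars and Bondi–Bartnik gap ≤ γ⟩ → ∃ S', (ε, k)-near-Kerr leaf with the same (N, M, a) and
S' ⊆ J⁺(S)`.
The tolerance `Λ` of the HYPOTHESIS leaf ranges over ALL `Λ < ⊤`, while the flat chart of a
near-Kerr leaf is certified only through `deviationCk (hypBackground U₀) Ψ₀ k' 0 ≤ Λ`, a `C^{k'}`
distance to the Minkowski form `η` with `‖η‖ = 1` (`Literature/Geometry/Lorentzian/DeviationTolerance.lean`,
`Minkowski.norm_bilin_eq_one`, `Spacetime.deviationCk_hypBackground_top_le`: for ANY map `Ψ₀`,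
`deviationCk ≤ ‖Ψ₀^* g‖_{C^{k'}} + 1`). Hence for `Λ > 1` the leaf clause is met by COLLAPSED
charts — a pinched lens over a tiny spacelike disc through any interior point `p`, inside any
neighbourhood `V` of `p`, at every order `k'` (line-lead dossiers `Cruxes/BondiBartnikRigidity/Lines/
Sketch-dead.md` §A, `Sketch-dead-c1.md` §2.1–2.2, and this seat's `Lines/hyperboloidal-mass-pinches-flat.dead.md`
§2) — and the hypothesis then says nothing about the radiation content of `J⁺(S) ⊆ J⁺(V)`.
In the simplest sector `N₀ = 0` (no collar, core `{p}`) the conclusion asks for an `(ε, k)`-FLAT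
complete hyperboloidal leaf inside `J⁺(S)`; on paper it fails on admissible maximal developments
in which the future of `V` is BLIND — every complete `ε`-flat hole-free hyperboloid in `J⁺(V)` meets
curvature `≫ ε` — while the cut of `p`'s cone still has a Bondi energy and a Bondi–Bartnik gap below
any prescribed `γ > 0`: Minkowski data plus a high-frequency, low-energy incoming swarm focusing on
the world-line of `p` (Sketch-dead-c1 §2.3 W2; admissible because `admissibleVacuumData` controls two
derivatives of `h` only), or — robust under ANY strengthening of the decay class — Minkowski data plus
ONE short incoming pulse, exactly Schwarzschild of mass `μ ≪ min(γ, ε)` outside a compact set, that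
collapses to a black hole at distance `10` from `p` a time `20` after `p` (this seat's dossier §3,
witness W3: before the collapse every hole-free leaf of `J⁺(V)` crosses the pulse where its `C²`
size is `≳ 1/(μ r) ≫ ε`, afterwards the hole of mass `≈ μ` obstructs every complete `ε`-flat
hole-free leaf; `p`'s cone is crossed by the pulse only weakly, so round receding families exist and
the own cut energy is `≈ μ ≤ γ/2`; the gap clause follows from positivity of competitor energies).

This file lands the kernel-checked part, as pure logic over the filed text:

* `bondiBartnikRigidity_false_of_blindCollapsedLeaves` (binder form): if for some target `(k, ε)`
  and EVERY `γ > 0` some admissible maximal development carries a point `p`, a set `V ∋ p` with blind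
  future (no `(ε, k)`-near-Kerr leaf with `0` holes inside `J⁺(V)`), collapsed `(2, k')`-leaves
  `S ∋ p` inside `V` at every order `k'`, a cut Bondi energy of `{p}` and Bondi–Bartnik gap `≤ γ` of
  `{p}`, then `BondiBartnikRigidity` fails (feed the item `χ = 0`, `m₀ = 1`, `N₀ = 0`, the `k'` it
  returns, `Λ = 2`, the `γ` it returns, and the witness at that `γ`; its leaf `S' ⊆ J⁺(S) ⊆ J⁺(V)`
  contradicts blindness);
* `bondiBartnikGapLE_singleton_of_le_of_nonneg`: the gap clause of the witness from its two
  physical inputs — an own cut energy `≤ γ` and non-negativity of competitor energies;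
* the construction hypothesis `BlindCollapsedLeafExists` (named `H` of the negative-modulo lane)
  and `BondiBartnikRigidity_false_of_blindCollapsedLeafExists : H → ¬ BondiBartnikRigidity`.

This is a NEGATIVE LEMMA MODULO `H`, not a refutation: `H` is an MGHD-level object with Bondi-energy
bookkeeping and a blindness property, none of which the tree can construct today (no
`VacuumCauchyDevelopment` of any radiating admissible datum, no `RoundSectionFamily`, no causal
analysis of collapsed charts). It certifies that the truth value of the item AS FILED is decided in
the junk-chart regime `Λ ≥ 1` of its simplest sector, and it is killed verbatim by the repair the
three lead dossiers agree on (`Λ < 1`, below the honesty threshold of DeviationTolerance.lean, where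
no collapsed leaf exists; `Cruxes/BondiBartnikRigidity/Lines/SketchRepairedStatement.lean`). The
route's thesis is untouched.

Line lead `prover-line-stmt-FinalStateConjecture-10807-a1-0`, 2026-08-16.
-/

noncomputable section

-- D-0017: single-problem summit, `Summit.<S>.<S>.…` by design (cf. lakefile `weak.linter.dupNamespace`).
set_option linter.dupNamespace false

open Set
open scoped Manifold ENNReal ContDiff Topology

namespace Summit.FinalStateConjecture.FinalStateConjecture.Theorems.BondiBartnikRigidity.Negative

open Literature.Geometry.Lorentzian
open Summit.FinalStateConjecture.FinalStateConjecture.Theses.BartnikGapSettling (BondiBartnikRigidity)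

/-- **The gap clause of the witness from its physical inputs.** If the cut of `𝓘⁺` generated by
the core `C` has a Bondi energy `m ≤ γ` and every competitor mass of `C` is non-negative
(positivity of the Bondi energy in admissible maximal developments), then the Bondi–Bartnik gap of
`C` is at most `γ` (`BondiBartnikGapLE`, by `Iff.rfl` the gap clause inlined in
`BondiBartnikRigidity`). [folklore] -/
theorem bondiBartnikGapLE_of_le_of_nonneg {X : Type} [TopologicalSpace X] [ChartedSpace E3 X]
    [IsManifold (𝓡 3) ∞ X] [ConnectedSpace X] {D : InitialDataSet (𝓡 3) X}
    {𝒟 : VacuumCauchyDevelopment D} {C : Set 𝒟.carrier} {γ m : ℝ}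
    (hm : 𝒟.toCauchyDevelopment.HasCutBondiMass C m) (hmγ : m ≤ γ)
    (hpos : ∀ m' : ℝ, 𝒟.IsCompetitorMass C m' → 0 ≤ m') : 𝒟.BondiBartnikGapLE C γ :=
  VacuumCauchyDevelopment.bondiBartnikGapLE_of_forall_le hm fun m' hm' => by
    linarith [hpos m' hm']

/-- **`BondiBartnikRigidity` is false on blind developments with collapsed leaves** (binder form;
the hypotheses are exactly the fields of `BlindCollapsedLeafExists`). Suppose that for some target
order `k` and tolerance `0 < ε`, and for EVERY `γ > 0`, there is a maximal vacuum Cauchy development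
`𝒟` of an admissible datum with a point `p` and a set `V ∋ p` such that: (J) at every order `k'`
some `(2, k')`-near-Kerr leaf `S` with `0` holes passes through `p` inside `V` (collapsed charts:
tolerance `2 > ‖η‖ = 1`); (C) the cut of the cone `∂J⁺{p}` has a Bondi energy; (G) the Bondi–Bartnik
gap of the core `{p}` is at most `γ`; (B) no `(ε, k)`-near-Kerr leaf with `0` holes lies inside
`J⁺(V)`. Then `BondiBartnikRigidity` fails. Proof: apply the item with `χ = 0`, `m₀ = 1`, `N₀ = 0`,
`(k, ε)`; at the order `k'` it returns take `Λ = 2 < ⊤`; at the `γ` it returns take the witness; with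
`N = 0` every collar clause is vacuous and the core is `{p}`, so the item yields an `(ε, k)`-leaf
`S' ⊆ J⁺(S) ⊆ J⁺(V)` (`causalFuture_mono`), against (B). [folklore] -/
theorem bondiBartnikRigidity_false_of_blindCollapsedLeaves (k : ℕ) (ε : ℝ≥0∞) (hε : 0 < ε)
    (hw : ∀ γ : ℝ, 0 < γ →
      ∃ (X : Type) (_ : TopologicalSpace X) (_ : ChartedSpace E3 X) (_ : IsManifold (𝓡 3) ∞ X)
        (_ : T2Space X) (_ : SecondCountableTopology X) (_ : ConnectedSpace X)
        (D : InitialDataSet (𝓡 3) X) (_ : D ∈ admissibleVacuumData X)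
        (𝒟 : VacuumCauchyDevelopment D) (_ : 𝒟.IsMaximal) (p : 𝒟.carrier) (V : Set 𝒟.carrier),
        (∀ k' : ℕ, ∃ (M a : Fin 0 → ℝ) (S : Set 𝒟.carrier),
          𝒟.toCauchyDevelopment.IsNearKerrLeaf k' 2 0 M a S ∧ p ∈ S ∧ S ⊆ V) ∧
        (∃ m : ℝ, 𝒟.toCauchyDevelopment.HasCutBondiMass ({p} : Set 𝒟.carrier) m) ∧
        𝒟.BondiBartnikGapLE ({p} : Set 𝒟.carrier) γ ∧
        ∀ (M a : Fin 0 → ℝ) (S' : Set 𝒟.carrier),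
          𝒟.toCauchyDevelopment.IsNearKerrLeaf k ε 0 M a S' →
          ¬ S' ⊆ 𝒟.metric.causalFuture 𝒟.timeOrientation V) :
    ¬ BondiBartnikRigidity := by
  intro h
  -- the item at margin 0, mass window 1, hole bound 0, target (k, ε)
  obtain ⟨k', hk'⟩ := h 0 1 0 k ε zero_lt_one one_pos hε
  -- the junk-chart tolerance Λ = 2
  obtain ⟨δ, γ, -, hγ, hmain⟩ := hk' 2 ENNReal.ofNat_lt_top
  -- the witness at the returned γ
  obtain ⟨X, _, _, _, _, _, _, D, hD, 𝒟, hmax, p, V, hjunk, hcut, hgap, hblind⟩ := hw γ hγ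
  obtain ⟨M, a, S, hleaf, hpS, hSV⟩ := hjunk k'
  -- feed the item: no collar (N = 0); every collar clause is vacuous over `Fin 0`
  have key := hmain X D hD 𝒟 0 M a S p (fun i => i.elim0) (fun i => i.elim0)
    (fun i => i.elim0) hmax le_rfl (fun i => i.elim0) hleaf hpS (fun i => i.elim0)
    (fun i => i.elim0) (fun i => i.elim0) (fun i => i.elim0) (fun i => i.elim0)
  -- the core `{p} ∪ ⋃ (i : Fin 0), …` is `{p}`
  simp only [iUnion_of_empty, union_empty] at key
  obtain ⟨S', hS', hS'S⟩ := key hcut hgap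
  exact hblind M a S' hS' (hS'S.trans (LorentzianMetric.causalFuture_mono hSV))

/-- **Physical form of the binder lemma.** The same conclusion with the gap clause (G) replaced by
its two physical inputs: (E) the cut of `p`'s cone has a Bondi energy `m ≤ γ` (everything radiated
after the retarded time of `p`, plus the final Bondi mass, weighs at most `γ`), and (P) every
competitor mass of `{p}` is non-negative (positivity of the Bondi energy in admissible maximal
developments receiving a neighbourhood of `p`). [folklore] -/
theorem bondiBartnikRigidity_false_of_blindCollapsedLeaves_of_nonneg (k : ℕ) (ε : ℝ≥0∞)
    (hε : 0 < ε)
    (hw : ∀ γ : ℝ, 0 < γ →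
      ∃ (X : Type) (_ : TopologicalSpace X) (_ : ChartedSpace E3 X) (_ : IsManifold (𝓡 3) ∞ X)
        (_ : T2Space X) (_ : SecondCountableTopology X) (_ : ConnectedSpace X)
        (D : InitialDataSet (𝓡 3) X) (_ : D ∈ admissibleVacuumData X)
        (𝒟 : VacuumCauchyDevelopment D) (_ : 𝒟.IsMaximal) (p : 𝒟.carrier) (V : Set 𝒟.carrier),
        (∀ k' : ℕ, ∃ (M a : Fin 0 → ℝ) (S : Set 𝒟.carrier),
          𝒟.toCauchyDevelopment.IsNearKerrLeaf k' 2 0 M a S ∧ p ∈ S ∧ S ⊆ V) ∧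
        (∃ m : ℝ, 𝒟.toCauchyDevelopment.HasCutBondiMass ({p} : Set 𝒟.carrier) m ∧ m ≤ γ) ∧
        (∀ m' : ℝ, 𝒟.IsCompetitorMass ({p} : Set 𝒟.carrier) m' → 0 ≤ m') ∧
        ∀ (M a : Fin 0 → ℝ) (S' : Set 𝒟.carrier),
          𝒟.toCauchyDevelopment.IsNearKerrLeaf k ε 0 M a S' →
          ¬ S' ⊆ 𝒟.metric.causalFuture 𝒟.timeOrientation V) :
    ¬ BondiBartnikRigidity := by
  refine bondiBartnikRigidity_false_of_blindCollapsedLeaves k ε hε fun γ hγ => ?_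
  obtain ⟨X, _, _, _, _, _, _, D, hD, 𝒟, hmax, p, V, hjunk, ⟨m, hm, hmγ⟩, hpos, hblind⟩ := hw γ hγ
  exact ⟨X, ‹_›, ‹_›, ‹_›, ‹_›, ‹_›, ‹_›, D, hD, 𝒟, hmax, p, V, hjunk, ⟨m, hm⟩,
    bondiBartnikGapLE_of_le_of_nonneg hm hmγ hpos, hblind⟩

/-- **Construction hypothesis `H` (a blind development with collapsed leaves).** For some target
order `k` and tolerance `0 < ε`, and for every `γ > 0`, some admissible datum has a maximal vacuum
Cauchy development `𝒟` with a point `p` and a set `V ∋ p` such that: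
(J) COLLAPSED LEAVES — at every order `k'` some `(2, k')`-near-Kerr leaf with `0` holes passes
through `p` inside `V` (on paper in EVERY development, for every interior point and neighbourhood:
the flat-chart clause `deviationCk ≤ Λ` certifies nothing for `Λ ≥ 1 = ‖η‖`,
`Spacetime.deviationCk_hypBackground_top_le`, and a pinched lens over a tiny spacelike disc
through `p` meets the remaining clauses of `IsNearKerrLeaf`; dossiers Sketch-dead-c1 §2.1–2.2 and
hyperboloidal-mass-pinches-flat.dead §2);
(C) the cut of the cone `∂J⁺{p}` has a Bondi energy (a round receding family with a Hawking-mass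
limit: `p`'s cone is neither captured nor strongly lensed);
(G) the Bondi–Bartnik gap of `{p}` is at most `γ` (on paper: own cut energy `≤ γ` plus positivity
of competitor energies, `bondiBartnikGapLE_of_le_of_nonneg`);
(B) BLINDNESS — no `(ε, k)`-near-Kerr leaf with `0` holes lies inside `J⁺(V)`.
Expected on paper (for `k = 2` and any small `ε`) for the MGHD of Minkowski data plus one short
incoming gravitational pulse, exactly Schwarzschild of mass `μ ≪ min(γ, ε)` outside a compact set,
collapsing to a black hole away from `p` after `p` (witness W3 of
`Cruxes/BondiBartnikRigidity/Lines/hyperboloidal-mass-pinches-flat.dead.md` §3), or plus a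
high-frequency low-energy incoming swarm (Sketch-dead-c1 §2.3 W2). NOT constructible in the tree
today (no maximal development of any radiating admissible datum; no round-section family; no causal
analysis of collapsed charts). It is killed by the repair `Λ < 1` of the item. -/
def BlindCollapsedLeafExists : Prop :=
  ∃ (k : ℕ) (ε : ℝ≥0∞), 0 < ε ∧ ∀ γ : ℝ, 0 < γ →
    ∃ (X : Type) (_ : TopologicalSpace X) (_ : ChartedSpace E3 X) (_ : IsManifold (𝓡 3) ∞ X)
      (_ : T2Space X) (_ : SecondCountableTopology X) (_ : ConnectedSpace X)
      (D : InitialDataSet (𝓡 3) X) (_ : D ∈ admissibleVacuumData X)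
      (𝒟 : VacuumCauchyDevelopment D) (_ : 𝒟.IsMaximal) (p : 𝒟.carrier) (V : Set 𝒟.carrier),
      (∀ k' : ℕ, ∃ (M a : Fin 0 → ℝ) (S : Set 𝒟.carrier),
        𝒟.toCauchyDevelopment.IsNearKerrLeaf k' 2 0 M a S ∧ p ∈ S ∧ S ⊆ V) ∧
      (∃ m : ℝ, 𝒟.toCauchyDevelopment.HasCutBondiMass ({p} : Set 𝒟.carrier) m) ∧
      𝒟.BondiBartnikGapLE ({p} : Set 𝒟.carrier) γ ∧
      ∀ (M a : Fin 0 → ℝ) (S' : Set 𝒟.carrier),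
        𝒟.toCauchyDevelopment.IsNearKerrLeaf k ε 0 M a S' →
        ¬ S' ⊆ 𝒟.metric.causalFuture 𝒟.timeOrientation V

/-- **Negative lemma modulo `BlindCollapsedLeafExists`**: blind developments with collapsed leaves,
one for each gap bound `γ > 0`, falsify `BondiBartnikRigidity` as filed (its `N₀ = 0` sector at the
junk-chart tolerance `Λ = 2`). [folklore] -/
theorem BondiBartnikRigidity_false_of_blindCollapsedLeafExists (H : BlindCollapsedLeafExists) :
    ¬ BondiBartnikRigidity := by
  obtain ⟨k, ε, hε, hw⟩ := H
  exact bondiBartnikRigidity_false_of_blindCollapsedLeaves k ε hε hw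

end Summit.FinalStateConjecture.FinalStateConjecture.Theorems.BondiBartnikRigidity.Negative

end
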